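import Mathlib.NumberTheory.ArithmeticFunction.Liouville
import Mathlib.NumberTheory.PrimeCounting
import Mathlib.NumberTheory.Chebyshev
import Literature.NumberTheory.Sieve.ParityBarrier
import HarnessLib

/-!
# Barrier catalogue `Parity`: Selberg's parity barrier (the parity problem of sieve theory)

Catalogue entry (D-0021) for the summit `Parity` (sub-problems `BatemanHorn`,
`GeneralizedHardyLittlewood`). One barrier per file; the structured block
(`technique_class / blocks / because / evasions_known / scope_caveats / status`) sits in the
docstring of the main declaration `Literature.Barriers.Parity.SelbergParityBarrier`.

* `SelbergParityBarrier` — the named fact: Selberg's sequence `a_n = 1 + λ(n)` satisfies the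
  Type-I ("well-distribution in arithmetic progressions") hypothesis `R(ν)` for EVERY `ν < 1`
  in Ford's normalisation `A(x) = x`, `g(d) = 1/d` [Ford2004, §1; Selberg 1949]. It needs the
  prime number theorem for `λ` with a saving of every power of `log`, which Mathlib lacks; hence
  a named fact, not a theorem, in this light-import file — DISCHARGED in the companion
  `SelbergParityProofs.lean` (`SelbergParityBarrier_holds`, from the tree's classical zero-free
  region; audited 2026-08-16: axioms `propext`, `Classical.choice`, `Quot.sound`), which also
  PROVES that the witness violates Ford's `(Pcond)` and Hooley's twisted condition at every level
  `α ≥ 0` (`selbergParity_not_parityCondition`, `selbergParity_not_hooleyCondition`: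
  `∑_{n ≤ x} (1 + λ(n)) μ(n) = 2 #{n ≤ x : μ(n) = 1} ≥ 2(π(x/2) − 1)`), i.e. that it does not
  obstruct the `μ`-twisted evasion recorded in `evasions_known`.
* proved from it: the bridge `SelbergParityBarrier.hasLevelOfDistribution` to the tree's
  sequence layer (`Literature.selbergParitySeq 1`, `Literature.NumberTheory.Sieve.HasLevelOfDistribution`); the tree's named
  facts `Literature.NumberTheory.Sieve.parity_barrier_typeI` and `Literature.NumberTheory.Sieve.no_typeI_prime_lower_bound`
  (`Literature/NumberTheory/Sieve/ParityBarrier.lean`, parity.S32 (i)) modulo the Mertens fact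
  `Literature.NumberTheory.Sieve.hasSieveDimension_reciprocalDensity_one`; and the all-moduli operational form
  `SelbergParityBarrier.no_typeI_prime_lower_bound_allModuli` (no functional of level-`x^ν`
  Type-I data bounds the prime mass of a non-negative sequence from below, any `ν < 1`).
* proved from Mathlib (Chebyshev): `nonPrimeIndicator_not_typeI` — deleting the primes from
  the integers is visible to Type-I data already at `d = 1` (`π(x) ≫ x / log x`), so the class
  in `no_typeI_prime_lower_bound_allModuli` is not defeated by the indicator of the non-primes;
  Selberg's sequence compensates the missing prime mass with density exactly `1/d` in every
  progression, which is where the prime number theorem for `λ` enters.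

* proved here (barrier audit 2026-08-16): the combinatorial core of the principal EVASION of the
  barrier by parity-sensitive (`μ`-twisted) Type-I data — `prime_of_squarefree_of_odd_of_rough` and
  `sum_oddSquarefree_rough_eq_sum_primes`: sifting the odd-`ω` squarefree part of any sequence to
  `z > x^{1/3}` leaves exactly its primes in `[z, x]`, so once the twisted sums
  `∑_{n ≤ x, d ∣ n} μ(n) a_n` are controlled alongside `A_d(x)` the prime mass becomes a
  dimension-one sifting function with `s = 3θ` and the linear-sieve lower bound (`s > 2`) bites
  (see `evasions_known`).

Bombieri's exact form of the phenomenon (asymptotic sieve: `Λ_k`, `k ≥ 2`, determined; `k = 1`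
determined only up to `α ∈ [0, 2]`) is already vendored in
`Literature/NumberTheory/Sieve/ParityBarrier.lean` (`Literature.NumberTheory.Sieve.bombieri_asymptotic_sieve`,
`Literature.NumberTheory.Sieve.bombieri_asymptotic_sieve_indeterminacy`, `Literature.NumberTheory.Sieve.prime_mass_le_two`) and is cited, not
restated. Ford's sharpening (no FIXED level `ν < 1` suffices even for `Λ_k`, `k ≥ 2`), the
Ford–Maynard Type-I/II thresholds and the circle-method obstruction are companion catalogue
entries proposed separately (planned files `FordFixedLevel.lean`, `FordMaynardPrimeSieves.lean`,
`CircleMethodBinary.lean` in this directory).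

## References (read at the cited pages)

* A. Selberg, *On elementary methods in primenumber-theory and their limitations*, 11. Skand.
  Mat. Kongress Trondheim 1949 (Oslo 1952), 13–22 = Collected Papers I, 388–397 (not held;
  statement taken from the secondary sources below).
* K. Ford, *On Bombieri's asymptotic sieve*, Trans. AMS 357 (2005), 1663–1674, §1.
* J. B. Friedlander, *Producing prime numbers via sieve methods*, LNM 1891 (2006), §1
  ("Parity Problem", "Bombieri's Sieve").
* E. Bombieri, *Selberg's sieve and its applications*, in: Number Theory, Trace Formulas and
  Discrete Groups (Oslo 1987), Academic Press 1989, §2.2–2.3.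
* G. Greaves, *Some remarks on the sieve method*, ibid., §1 and §2, (2.10)–(2.11).
* A. C. Cojocaru, M. R. Murty, *An introduction to sieve methods and their applications*
  (2005), Ch. 5, Exercise 20.
* G. Harman, *Prime-Detecting Sieves*, LMS Monographs 33 (2007), §14.1 (14.1.1)–(14.1.3),
  pp. 335–336, and §12.6 (read at the cited pages).
* K. Ford, J. Maynard, *On the theory of prime producing sieves*, arXiv:2407.14368 (2024), §1
  and the Remark after Proposition 4.10 (arXiv pp. 3, 13).
* M. Ram Murty, A. Vatwani, *Twin primes and the parity problem*, J. Number Theory 180 (2017),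
  643–659 (paywalled, acq-00016; statement via Vatwani's thesis §7.1 as recorded in
  `PrimePairParityProofs.lean`).
* J. B. Friedlander, H. Iwaniec, *Exceptional zeros, sieve parity, Goldbach*, Essential Number
  Theory 1 (2022), 13–39, §2 (pp. 16–19) and §11 (p. 31) (read at the cited pages).
-/

noncomputable section

open Filter Asymptotics Finset

namespace Literature.Barriers.Parity

/-- **Selberg's parity barrier (the parity problem).** Selberg's sequence `a_n = 1 + λ(n)`
(`λ` = Liouville's function, Mathlib `ArithmeticFunction.liouville`; `a_n = 2` if `Ω(n)` is
even, `0` if `Ω(n)` is odd) has, with `A(x) = x` and `g(d) = 1/d`, the well-distribution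
property `R(ν)` for EVERY `ν < 1`: for all `B > 0`,
`∑_{d ≤ x^ν} |A_d(x) − x/d| ≪_{ν,B} x (log x)^{−B}`, `A_d(x) = ∑_{n ≤ x, d ∣ n} a_n`
(a consequence of `∑_{n ≤ y} λ(n) ≪ y exp(−c √log y)`); nevertheless `a_p = 0` for every prime
`p` and `S₁(x) = ∑_{n ≤ x} a_n Λ(n) = O(√x)`: "sieve methods cannot produce" the prime
asymptotic `S₁(x) ∼ H A(x)`. The Prop is the distribution statement as printed by Ford (the
cases `ν ≤ 0` are trivial); the vanishing on primes is the tree's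
`Literature.NumberTheory.Sieve.selbergParitySeq_one_apply_prime`, and the impossibility of a Type-I lower bound for
primes is PROVED from the Prop below. [cite: Ford2004, §1] [cite: Selberg1952Limitations] [cite: Friedlander2006ProducingPrimes, §1 Parity Problem] [cite: CojocaruMurty2005, Ch. 5 Exercise 20]

BARRIER (D-0021; one line per key):
technique_class: sieve type-I level-of-distribution combinatorial-sieve selberg-sieve linear-sieve
blocks: every positive lower bound — a fortiori every asymptotic such as `BatemanHorn`, `Literature.NumberTheory.Sieve.HardyLittlewoodConjE` or twin primes — for the prime mass `∑_p a_p` of a non-negative sequence that is derived only from its Type-I data (`A_d(x) = g(d) X + r_d`, `∑_{d ≤ x^ν} |r_d| ≪ X (log x)^{−B}`) at ANY level `ν < 1` (proved below as `SelbergParityBarrier.no_typeI_prime_lower_bound_allModuli` and, on the tree's sequence layer, `Literature.NumberTheory.Sieve.no_typeI_prime_lower_bound`) [cite: Ford2004, §1]; by the same example the choice `z = D^{1/2−ε}` in the linear sieve lower bound is best possible ("any such result with `z` replaced by `D^{1/2+ε}` would be false"), i.e. the sieving limit `2` in `f(s) > 0 (s > 2)` "cannot be replaced by a smaller number `2 −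 δ`" [cite: Greaves1989SieveRemarks, §1 and §2 (2.10)–(2.11)] [cite: Bombieri1989SelbergSieve, §2.2–2.3 (α(1) = 1/2; extremal sets Ω(n) odd/even)].
because: `1 + λ(n)` and `1 − λ(n)` (integers with an even, resp. odd, number of prime factors) have identical Type-I data — `X = x`, `g(d) = 1/d`, level `x^{1−ε}` for every `ε > 0` — but prime mass `0`, resp. `2π(x)`, so no function of Type-I data separates them [cite: Ford2004, §1]; Bombieri's asymptotic sieve makes this exact: level `x^{1−ε}` (all `ε`) determines `∑ a_n Λ_k(n) ∼ k H A(x) (log x)^{k−1}` for every `k ≥ 2`, while `∑ a_n Λ(n) ∼ α H A(x)` can only be asserted with `0 ≤ α ≤ 2`, every `α` occurring [cite: Friedlander2006ProducingPrimes, §1 Theorem (Bombieri)] [cite: BombieriAsymptoticSieve1976] (tree: `Literature.NumberTheory.Sieve.bombieri_asymptotic_sieve`, `Literature.NumberTheory.Sieve.bombieri_asymptotic_sieve_indeterminacy`, `Literature.NumberTheory.Sieve.prime_mass_le_two`).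
evasions_known: supply non-Type-I ("parity-breaking") arithmetic input — bilinear (Type-II) sums as in the Friedlander–Iwaniec asymptotic sieve for primes (`x² + y⁴`) and its variants [cite: Ford2004, §1] [cite: FriedlanderIwaniecASP1998] [cite: FriedlanderIwaniecAnnals1998] [cite: HeathBrownActa2001]; how much Type-II range is necessary is itself bounded below (Ford–Maynard, "Minimal Type II range"; companion catalogue entry `FordMaynardPrimeSieves`, proposed separately) [cite: FordMaynard2024PrimeSieves, Theorem 2.1]; for a single polynomial of degree `2` in one variable (`m² + 1`, the first case of `BatemanHorn`) producing primes is a famous open problem [cite: Friedlander2006ProducingPrimes, §1 Example 2]; (audit 2026-08-16) PARITY-SENSITIVE TYPE-I DATA evade with NO Type-II width at all, so the Ford–Maynard lower bound on the necessary Type-II range concerns the (I)/(II) axiom system only: the inputs are the `μ`-twisted congruence sums `H_d(x) = ∑_{n ≤ x, d ∣ n} μ(n) a_n` — "in Chapter 12 the parity problem was overcome by estimating sums like `∑_{d∼D} |∑_{nd∈𝒜} μ(n)|`" [cite: Harman2007, §14.1 (14.1.3), pp. 335–336; §12.6], Hooley's averaged condition `∑_{d ≤ x^α} |H_d(x)|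 ≪_B x(log x)^{−B}`, met by Ford's fixed-level examples only for `α < 1 − ν` ("the case `α + ν > 1` remains open", for the failure of `(S_k)`) [cite: Ford2004, §1 (Theorem 2 and the discussion following it)], and, for the twin sequence, Murty–Vatwani's `CE(θ)` (`μ` at shifted primes in progressions, all `θ < 1/2`) with `GEH(θ)` (all `θ < 1`) giving the twin-prime asymptotic [cite: MurtyVatwani2017] [cite: Vatwani2016, §7.1]; quantitatively (routine from PROVED tree theorems, not found in print): if `0 ≤ a_n ≤ C`, `R(ν)` holds and `∑_{d ≤ x^α} |H_d(x)| ≪_B x(log x)^{−B}` with `θ := min(ν, α) > 2/3`, then `∑_{p ≤ x} a_p ≥ (3 log(3θ′ − 1)/(3θ′) − o(1)) x/log x` and `≤ (1/θ′ + o(1)) x/log x` for every `θ′ < θ` — the odd part `a⁻_n = a_n μ²(n)(1 − μ(n))/2 ≥ 0` has Type-I data `A_d(a⁻) = ½(∑_{e ≤ (log x)^C} μ(e) A_{[d,e²]} − H_d) + O(τ(d) x/(d (log x)^C))`, i.e. `X = 3x/π²`, `g(p) = 1/(p+1)`, level `x^{θ−ε}`, and sifting it to `z = x^{1/3}` isolates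 the primes (`sum_oddSquarefree_rough_eq_sum_primes` below), so the Jurkat–Richert lower bound `f(s) = 2e^γ log(s−1)/s > 0` at `s = 3θ′ > 2` applies (tree: `Literature.NumberTheory.Sieve.LinearSieve.jurkatRichert_lower_allLevels`, PROVED) [cite: Nathanson1996, Thm 9.7 (9.36) and Thm 9.8]; with `R(ν)` and Hooley's condition for ALL `ν, α < 1` Bombieri's sieve for `k = 2` applied to `a⁻` (`H⁻ = ζ(2)`, `∑ a⁻ Λ₂ = ∑_p a_p log² p ∼ x log x`) even returns the asymptotic `(S_1)` (tree: `Literature.NumberTheory.Sieve.bombieri_asymptotic_sieve`, PROVED) [cite: BombieriAsymptoticSieve1976]; CONDITIONAL parity input from exceptional characters: if Siegel zeros exist the real character "pretends to be the Möbius function on squarefree numbers", the twisted sums become computable and Heath-Brown obtains infinitely many twin primes, Friedlander–Iwaniec primes in further sequences [cite: FriedlanderIwaniec2022, §11 (p. 31) and §2–3 (pp. 16–19)] [cite: Harman2007, §14.2 p. 336].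
scope_caveats: the Prop transcribes only `R(ν)` for Selberg's sequence in Ford's normalisation (all moduli `d ≤ x^ν`, `A(x) = x`, `g(d) = 1/d`) [cite: Ford2004, §1]; what is PROVED from it here is the no-lower-bound statement for the PRIME mass (`z = √x`), not the optimality of the linear-sieve functions `f, F` for general `s` — Greaves states that Selberg's example shows `f` "is best possible for all `s`" but "the details of this have not been published" [cite: Greaves1989SieveRemarks, §2 (after (2.11))] — since published: Selberg's sets `{2X ≤ a < 4X : Ω(a) odd / even}` ATTAIN `F` and `f` for every `s ≥ 1` [cite: Greaves2001, §4.5.1 Theorem 1], PROVED in the tree as `Literature.Barriers.Parity.LinearSieveOptimality_holds` (entry `LinearSieveOptimality.lean`); the barrier limits what follows from one-sequence Type-I data ALONE and asserts nothing about a specific arithmetic sequence (such as the values of a polynomial) for which further structure is available [cite: Friedlander2006ProducingPrimes, §1 Parity Problem]; Selberg's 1949 text is not held — the statement is taken from Ford, Friedlander, Bombieri and Greaves [cite: Ford2004, §1]; (audit 2026-08-16) what is PROVED covers exactly: homogeneous classes `d ∣ n`, the normalisation `(A(x), g) = (x, 1/d)`, logarithmic savings — in ANY norm, since the example's remainders are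 pointwise `≤ 1 + |L(⌊x⌋/d)|` (`SelbergParityProofs.abs_typeI_term_le`), so `ℓ¹`, pointwise, well-factorable/bilinear-remainder and `sup_{y ≤ x}` hypotheses of level `x^ν`, `ν < 1`, are all met, indeed up to level `x·exp(−(log log x)^{c})`; NOT covered unconditionally (conditionalities, not openings — an unconditional prime-detecting theorem from such inputs alone would refute the conjecture named): classes `n ≡ a (mod d)`, `a ≠ 0`, beyond level `x^{1/2}` (Selberg's sequence is integer-like there only under Elliott–Halberstam for `λ`; unconditionally Bombieri–Vinogradov for `λ`), power savings `x^{−η}` at level `ν ≥ 1/2` (under RH `L(y) ≪ y^{1/2+ε}`; for `ν < 1/2` rough-`pq` constructions give them unconditionally) [cite: FordMaynard2024PrimeSieves, Theorem 4.16 (proof) and §2.3], other dimension-one densities `g = h(d)/d` (`h(n)(1 + λ(n))`, prime number theorem for `hλ`; routine, unformalised), and thin `{0,1}`-valued sequences of mass `x^{1−c}`, which are covered only after reweighting (`h(n)(1+λ(n)) n^{−c}`), no prime-free SUBSET of a thin set with an irreducible-polynomial density profile and level `X^{1−ε}` being known unconditionally (for `m² + 1` the twisted-Type-I evasion above would need level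 `> x^{2/3} = X^{4/3}` in element size) [cite: FordMaynard2024PrimeSieves, §1 (I)–(II) and the Remark after Proposition 4.10 (arXiv p. 13)]; GLOBAL unbiasedness alone (`P(x) = ∑_{n ≤ x} a_n μ(n) ≪_B x(log x)^{−B}`, the `d = 1` case of Hooley's condition) does NOT evade at low level: for every `ν < 1/2` the bounded prime-free sequence `a_n = 1 − 1_ℙ(n) + t(n)λ(n)1[n composite] + w_n`, `t(n) = −(π²/3)/(log n − π²/3)` (`n > 720`), `w ≥ 0` smooth weights of total `π(x) − ∑_{p ≤ x} t(p)` on the products `pq`, `p > (pq)^β`, `β ∈ (ν, 1/2)`, satisfies `R(ν)` and `P(x) ≪_B x(log x)^{−B}` (this audit; answers the `k = 1` case of Ford's question for `ν < 1/2`), while whether `R(ν)` with `P(x)` small forces primes for `ν ∈ [1/2, 1)` is OPEN [cite: Ford2004, §1 (the question before Theorem 2)].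
status: established (PROVED in the tree: `SelbergParityBarrier_holds`, `SelbergParityProofs.lean`); barrier audit 2026-08-16: CONFIRMED as stated (technique class exactly covered), `evasions_known` NARROWED/sharpened — parity-sensitive Type-I data (`μ`-twisted congruence sums) evade with zero Type-II width; combinatorial core proved below (`sum_oddSquarefree_rough_eq_sum_primes`) -/
def SelbergParityBarrier : Prop :=
  ∀ ν : ℝ, ν < 1 → ∀ B : ℝ, 0 < B →
    (fun x : ℝ => ∑ d ∈ Icc 1 ⌊x ^ ν⌋₊,
        |(∑ n ∈ (Ioc 0 ⌊x⌋₊).filter (d ∣ ·), (1 + (ArithmeticFunction.liouville n : ℝ))) -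
          x / d|) =O[atTop]
      fun x : ℝ => x / Real.log x ^ B

/-! ### Proved consequences -/

/-- `SelbergParityBarrier` restated for the terms `(selbergParitySeq 1).a n = 1 + λ(n)` of the
tree's sifted sequence (rewriting with `Literature.NumberTheory.Sieve.selbergParitySeq_a`). [cite: Ford2004, §1] -/
theorem SelbergParityBarrier.typeI_selbergParitySeq_one (h : SelbergParityBarrier) {ν : ℝ}
    (hν : ν < 1) {B : ℝ} (hB : 0 < B) :
    (fun x : ℝ => ∑ d ∈ Icc 1 ⌊x ^ ν⌋₊,
        |(∑ n ∈ (Ioc 0 ⌊x⌋₊).filter (d ∣ ·), (Literature.NumberTheory.Sieve.selbergParitySeq 1).a n) - x / d|) =O[atTop]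
      fun x : ℝ => x / Real.log x ^ B := by
  simpa only [Literature.NumberTheory.Sieve.selbergParitySeq_a, Units.val_one, Int.cast_one, one_mul] using h ν hν B hB

/-- Bridge to the tree's sequence layer: `SelbergParityBarrier` gives the sifted sequence
`Literature.selbergParitySeq 1` (`a_n = 1 + λ(n)`, `X(x) = x`, `g(d) = 1/d`) level of distribution
`x^θ` for every `θ < 1` in the sense of `Literature.NumberTheory.Sieve.HasLevelOfDistribution` (level `x^{θ−ε}` for all
`ε > 0`, remainders summed over square-free `d` only — a sub-sum of Ford's `R(θ − ε)`). This is
the `sgn = 1` half of the tree's named fact `Literature.NumberTheory.Sieve.selbergParitySeq_hasLevelOfDistribution`.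
[cite: Ford2004, §1] -/
theorem SelbergParityBarrier.hasLevelOfDistribution (h : SelbergParityBarrier) {θ : ℝ}
    (hθ : θ < 1) : Literature.NumberTheory.Sieve.HasLevelOfDistribution (Literature.NumberTheory.Sieve.selbergParitySeq 1) θ := by
  intro ε hε B hB
  have hO := h.typeI_selbergParitySeq_one (ν := θ - ε) (by linarith) hB
  refine IsBigO.trans ?_ hO
  refine IsBigO.of_bound 1 (Eventually.of_forall fun x => ?_)
  have hterm : ∀ d : ℕ, |(Literature.NumberTheory.Sieve.selbergParitySeq 1).remainder d x| =
      |(∑ n ∈ (Ioc 0 ⌊x⌋₊).filter (d ∣ ·), (Literature.NumberTheory.Sieve.selbergParitySeq 1).a n) - x / d| := by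
    intro d
    simp only [Literature.NumberTheory.Sieve.SieveSequence.remainder, Literature.NumberTheory.Sieve.SieveSequence.congrSum, Literature.NumberTheory.Sieve.selbergParitySeq_size,
      Literature.NumberTheory.Sieve.selbergParitySeq_density, Literature.NumberTheory.Sieve.reciprocalDensity_apply, div_eq_mul_inv, mul_comm x]
  have hnn : ∀ d : ℕ,
      0 ≤ |(∑ n ∈ (Ioc 0 ⌊x⌋₊).filter (d ∣ ·), (Literature.NumberTheory.Sieve.selbergParitySeq 1).a n) - x / d| :=
    fun d => abs_nonneg _
  rw [one_mul, Real.norm_of_nonneg (sum_nonneg fun d _ => abs_nonneg _),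
    Real.norm_of_nonneg (sum_nonneg fun d _ => hnn d)]
  simp_rw [hterm]
  exact sum_le_sum_of_subset_of_nonneg (filter_subset _ _) fun d _ _ => hnn d

/-- **parity.S32 (i) from the named fact**: `SelbergParityBarrier` together with the Mertens
fact `Literature.NumberTheory.Sieve.hasSieveDimension_reciprocalDensity_one` (the density `1/d` has sieve dimension `1`)
proves the tree's `Literature.NumberTheory.Sieve.parity_barrier_typeI` — for every `θ < 1` a sifted sequence with
`X(x) = x`, level `x^θ`, dimension `1` and no mass on primes (witness `selbergParitySeq 1`).
[cite: Ford2004, §1] [cite: Friedlander2006ProducingPrimes, §1 Parity Problem] -/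
theorem SelbergParityBarrier.parity_barrier_typeI (h : SelbergParityBarrier)
    (hdim : Literature.NumberTheory.Sieve.hasSieveDimension_reciprocalDensity_one) : Literature.NumberTheory.Sieve.parity_barrier_typeI :=
  fun _ hθ => ⟨Literature.NumberTheory.Sieve.selbergParitySeq 1, fun _ => rfl, h.hasLevelOfDistribution hθ, hdim,
    fun _ hp => Literature.NumberTheory.Sieve.selbergParitySeq_one_apply_prime hp⟩

/-- **No Type-I lower bound for primes, tree form**: `SelbergParityBarrier` and the Mertens
fact `Literature.NumberTheory.Sieve.hasSieveDimension_reciprocalDensity_one` prove the tree's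
`Literature.NumberTheory.Sieve.no_typeI_prime_lower_bound` — for `θ < 1` and every admissible dimension constant `K`,
no `c > 0` makes `∑_{p ≤ x} a_p ≥ c x / log x` (large `x`) a consequence of `X(x) = x`, level
`x^θ` and dimension `1`: `selbergParitySeq 1` has prime mass `0`
(`Literature.NumberTheory.Sieve.selbergParitySeq_one_sum_primes`). [cite: Ford2004, §1] [cite: Friedlander2006ProducingPrimes, §1 Parity Problem] -/
theorem SelbergParityBarrier.no_typeI_prime_lower_bound (h : SelbergParityBarrier)
    (hdim : Literature.NumberTheory.Sieve.hasSieveDimension_reciprocalDensity_one) : Literature.NumberTheory.Sieve.no_typeI_prime_lower_bound := by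
  intro θ hθ
  obtain ⟨K₀, hK₀⟩ := hdim
  refine ⟨K₀, fun K hK => ?_⟩
  rintro ⟨c, hc, H⟩
  have hev := H (Literature.NumberTheory.Sieve.selbergParitySeq 1) (fun _ => rfl) (h.hasLevelOfDistribution hθ)
    (hK₀.mono le_rfl hK)
  obtain ⟨x, hx, hx1⟩ := (hev.and (eventually_gt_atTop 1)).exists
  rw [Literature.NumberTheory.Sieve.selbergParitySeq_one_sum_primes] at hx
  exact absurd hx (not_le.mpr (div_pos (mul_pos hc (by linarith)) (Real.log_pos hx1)))

/-- **No Type-I lower bound for primes, all-moduli form** (proved from `SelbergParityBarrier`;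
no dimension hypothesis is needed because the density is fixed to `1/d`): for every `ν < 1`
there is NO constant `c > 0` such that every non-negative sequence `(a_n)` with the Type-I data
of the integers at level `x^ν` — `∑_{d ≤ x^ν} |A_d(x) − x/d| ≪_B x (log x)^{−B}` for all `B`,
all moduli `d` — has prime mass `∑_{p ≤ x} a_p ≥ c x / log x` for all large `x`: Selberg's
`1 + λ(n)` is admissible and has prime mass `0`. The `d = 1` term of the hypothesis forces
`∑_{n ≤ x} a_n = x + O_B(x (log x)^{−B})`, so a sequence vanishing on the primes must carry the
missing mass `≍ x / log x` elsewhere with density exactly `1/d` in every progression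
`d ≤ x^ν` (cf. `nonPrimeIndicator_not_typeI`); for `ν ≤ 0` the hypothesis is empty or reduces
to `d = 1` and the statement is elementary. For `ν` close to `1` (sieving the integers-like
sequence up to `z = √x > D^{1/2}`, `D = x^ν`) this is the prime case of Greaves' remark that
`z = D^{1/2−ε}` cannot be replaced by `D^{1/2+ε}`. [cite: Ford2004, §1] [cite: Greaves1989SieveRemarks, §1] [cite: Friedlander2006ProducingPrimes, §1 Parity Problem] -/
theorem SelbergParityBarrier.no_typeI_prime_lower_bound_allModuli (h : SelbergParityBarrier)
    {ν : ℝ} (hν : ν < 1) :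
    ¬ ∃ c : ℝ, 0 < c ∧ ∀ a : ℕ → ℝ, (∀ n, 0 ≤ a n) →
      (∀ B : ℝ, 0 < B →
        (fun x : ℝ => ∑ d ∈ Icc 1 ⌊x ^ ν⌋₊,
            |(∑ n ∈ (Ioc 0 ⌊x⌋₊).filter (d ∣ ·), a n) - x / d|) =O[atTop]
          fun x : ℝ => x / Real.log x ^ B) →
      ∀ᶠ x : ℝ in atTop, c * x / Real.log x ≤ ∑ p ∈ Nat.primesLE ⌊x⌋₊, a p := by
  rintro ⟨c, hc, H⟩
  have hev := H (Literature.NumberTheory.Sieve.selbergParitySeq 1).a (Literature.NumberTheory.Sieve.selbergParitySeq 1).a_nonneg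
    fun B hB => h.typeI_selbergParitySeq_one hν hB
  obtain ⟨x, hx, hx1⟩ := (hev.and (eventually_gt_atTop 1)).exists
  rw [Literature.NumberTheory.Sieve.selbergParitySeq_one_sum_primes] at hx
  exact absurd hx (not_le.mpr (div_pos (mul_pos hc (by linarith)) (Real.log_pos hx1)))

/-- **Deleting the primes is visible to Type-I data.** For `ν ≥ 0` the indicator of the
non-primes, `a_n = 1 − 1_ℙ(n)`, does NOT have the Type-I data of the integers at level `x^ν`:
its `d = 1` remainder is `A_1(x) − x = −π(⌊x⌋) − {x}`, and `π(x) ≥ ((x−1) log 2 − log(x+2))/log x`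
(Chebyshev; Mathlib `Chebyshev.pi_ge'`) is not `O(x (log x)^{−2})`. Hence the class of sequences
in `SelbergParityBarrier.no_typeI_prime_lower_bound_allModuli` is not defeated by simply
removing the primes; Selberg's `1 + λ(n)` redistributes the prime mass invisibly to every
progression, by the prime number theorem for `λ`. [folklore] [cite: Ford2004, §1] -/
theorem nonPrimeIndicator_not_typeI {ν : ℝ} (hν : 0 ≤ ν) :
    ¬ ∀ B : ℝ, 0 < B →
      (fun x : ℝ => ∑ d ∈ Icc 1 ⌊x ^ ν⌋₊,
          |(∑ n ∈ (Ioc 0 ⌊x⌋₊).filter (d ∣ ·), (if n.Prime then (0 : ℝ) else 1)) - x / d|)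
        =O[atTop] fun x : ℝ => x / Real.log x ^ B := by
  intro H
  obtain ⟨C, hC⟩ := (H 2 two_pos).bound
  -- the `d = 1` term alone is at least `π(⌊x⌋₊)`
  have hlow : ∀ x : ℝ, 1 ≤ x → (Nat.primeCounting ⌊x⌋₊ : ℝ) ≤
      ∑ d ∈ Icc 1 ⌊x ^ ν⌋₊,
        |(∑ n ∈ (Ioc 0 ⌊x⌋₊).filter (d ∣ ·), (if n.Prime then (0 : ℝ) else 1)) - x / d| := by
    intro x hx
    have h1 : 1 ∈ Icc 1 ⌊x ^ ν⌋₊ := by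
      rw [mem_Icc]
      exact ⟨le_rfl, Nat.le_floor (by exact_mod_cast Real.one_le_rpow hx hν)⟩
    refine le_trans ?_ (single_le_sum (f := fun d => |(∑ n ∈ (Ioc 0 ⌊x⌋₊).filter (d ∣ ·),
      (if n.Prime then (0 : ℝ) else 1)) - x / d|) (fun d _ => abs_nonneg _) h1)
    have hfilter : (Ioc 0 ⌊x⌋₊).filter ((1 : ℕ) ∣ ·) = Ioc 0 ⌊x⌋₊ :=
      filter_true_of_mem fun n _ => one_dvd n
    have hprimes : (Ioc 0 ⌊x⌋₊).filter Nat.Prime = Nat.primesLE ⌊x⌋₊ := by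
      ext p
      simp only [mem_filter, mem_Ioc, Nat.mem_primesLE]
      constructor
      · rintro ⟨⟨-, hp⟩, hpr⟩
        exact ⟨hp, hpr⟩
      · rintro ⟨hp, hpr⟩
        exact ⟨⟨hpr.pos, hp⟩, hpr⟩
    -- `∑_{n ≤ N} (1 - 1_ℙ(n)) = N - π(N)`
    have hsum : ∑ n ∈ Ioc 0 ⌊x⌋₊, (if n.Prime then (0 : ℝ) else 1) =
        (⌊x⌋₊ : ℝ) - Nat.primeCounting ⌊x⌋₊ := by
      have hsplit : ∀ n : ℕ, (if n.Prime then (0 : ℝ) else 1) =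
          1 - (if n.Prime then (1 : ℝ) else 0) := fun n => by split_ifs <;> norm_num
      simp_rw [hsplit, sum_sub_distrib, sum_const, Nat.card_Ioc, Nat.sub_zero, nsmul_eq_mul,
        mul_one, sum_boole, hprimes, Nat.primesLE_card_eq_primeCounting]
    simp only [hfilter, Nat.cast_one, div_one]
    rw [hsum]
    have hfl : (⌊x⌋₊ : ℝ) ≤ x := Nat.floor_le (by linarith)
    have hπ : (0 : ℝ) ≤ Nat.primeCounting ⌊x⌋₊ := Nat.cast_nonneg _
    rw [abs_sub_comm, abs_of_nonneg (by linarith)]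
    linarith
  -- sample a large `x` where the bound, `x ≥ 8`, `log x ≤ (log 2 / 4) x` and
  -- `4 C / log 2 ≤ log x` all hold
  have hl2 : 0 < Real.log 2 := Real.log_pos one_lt_two
  have hlog4 : ∀ᶠ x : ℝ in atTop, Real.log x ≤ Real.log 2 / 4 * x := by
    have := Real.isLittleO_log_id_atTop.bound (div_pos hl2 four_pos)
    filter_upwards [this, eventually_ge_atTop 1] with x hx hx1
    rwa [Real.norm_of_nonneg (Real.log_nonneg hx1), id, Real.norm_of_nonneg (by linarith)] at hx
  have hlogC : ∀ᶠ x : ℝ in atTop, 4 * C / Real.log 2 ≤ Real.log x :=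
    Real.tendsto_log_atTop.eventually_ge_atTop _
  obtain ⟨x, hxC, hx8, hxlog, hxlogC⟩ :=
    (hC.and ((eventually_ge_atTop 8).and (hlog4.and hlogC))).exists
  have hx1 : (1 : ℝ) < x := by linarith
  have hlogpos : 0 < Real.log x := Real.log_pos hx1
  -- upper bound at `x`: `π(⌊x⌋₊) ≤ C x / log² x`
  have hup : (Nat.primeCounting ⌊x⌋₊ : ℝ) ≤ C * x / Real.log x / Real.log x := by
    have h' := hxC
    rw [Real.norm_of_nonneg (sum_nonneg fun d _ => abs_nonneg _),
      Real.norm_of_nonneg (div_nonneg (by linarith) (Real.rpow_nonneg hlogpos.le _))] at h'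
    have hEq : C * (x / Real.log x ^ (2 : ℝ)) = C * x / Real.log x / Real.log x := by
      rw [Real.rpow_two]
      ring
    exact ((hlow x hx1.le).trans h').trans hEq.le
  -- lower bound at `x`: Chebyshev
  have hcomb := (Chebyshev.pi_ge' hx1).trans hup
  rw [div_le_iff₀ hlogpos, div_mul_cancel₀ _ hlogpos.ne'] at hcomb
  -- `log (x + 2) ≤ log 2 + log x`
  have hlogx2 : Real.log (x + 2) ≤ Real.log 2 + Real.log x := by
    rw [← Real.log_mul two_ne_zero (by linarith : x ≠ 0)]
    exact Real.log_le_log (by linarith) (by linarith)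
  -- `C x / log x ≤ (log 2 / 4) x`
  have hCx : C * x / Real.log x ≤ Real.log 2 / 4 * x := by
    rw [div_le_iff₀ hlogpos]
    have h4 : 4 * C ≤ Real.log x * Real.log 2 := (div_le_iff₀ hl2).mp hxlogC
    have h4x : x * (4 * C) ≤ x * (Real.log x * Real.log 2) :=
      mul_le_mul_of_nonneg_left h4 (by linarith)
    linarith
  have h8l : 8 * Real.log 2 ≤ x * Real.log 2 := mul_le_mul_of_nonneg_right hx8 hl2.le
  linarith

/-! ### The parity split isolates the primes (core of the `μ`-twisted Type-I evasion)

Barrier audit 2026-08-16 (`evasions_known` above). For ANY weights `a`, the part of the sequence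
supported on squarefree integers with an odd number of prime factors, once sifted by the primes
below `z > x^{1/3}`, consists of primes only. Consequently Type-I data for `a_n 1[μ(n) = −1]` —
available from `A_d(x)` together with the twisted sums `∑_{n ≤ x, d ∣ n} μ(n) a_n` — turn the
prime mass into a dimension-one sifting function with `s = log D/log z = 3θ`, to which the
Jurkat–Richert lower bound (`Literature.NumberTheory.Sieve.LinearSieve.jurkatRichert_lower_allLevels`,
proved in the tree) applies as soon as `θ > 2/3`; Selberg's `1 + λ(n)` is no counterexample there
because its twisted sums `∑_{d ∣ n} μ(n)(1 + λ(n)) = μ(d) M_d(x/d) + ∑_{d ∣ n} μ²(n)` are as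
large as `(6/π²) ∏_{p ∣ d} (p/(p+1)) · x/d`. -/

section ParitySplit

open scoped ArithmeticFunction.omega

/-- A squarefree `n` all of whose prime factors are `≥ z ≥ 0` satisfies `z ^ ω(n) ≤ n`
(`ω(n) = #primeFactors(n)` and `n = ∏_{p ∣ n} p`). [folklore] -/
theorem pow_cardDistinctFactors_le_of_le_primeFactors {n : ℕ} (hn : Squarefree n) {z : ℝ}
    (hz : 0 ≤ z) (hrough : ∀ p ∈ n.primeFactors, z ≤ (p : ℝ)) :
    z ^ ω n ≤ (n : ℝ) := by
  have hω : ω n = n.primeFactors.card := by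
    rw [ArithmeticFunction.cardDistinctFactors_apply, ← List.card_toFinset]; rfl
  rw [hω]
  calc z ^ n.primeFactors.card = ∏ _p ∈ n.primeFactors, z := by rw [prod_const]
    _ ≤ ∏ p ∈ n.primeFactors, (p : ℝ) := prod_le_prod (fun _ _ => hz) hrough
    _ = (n : ℝ) := by rw [← Nat.cast_prod, Nat.prod_primeFactors_of_squarefree hn]

/-- **The parity split makes the primes sieve-isolable.** A squarefree `n ≤ x` with an ODD number
of prime factors and no prime factor below `z`, where `z³ > x`, is a prime: `ω(n) ≥ 3` would force
`n ≥ z³ > x`, and `ω(n) = 1` with `n` squarefree means `n` is prime. This is the combinatorial core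
of the evasion of Selberg's barrier by `μ`-twisted Type-I data (see `evasions_known` of
`SelbergParityBarrier`): on the sequence `a_n · 1[n squarefree, ω(n) odd]` — whose Type-I data are
`(A_d(a μ²) − ∑_{d ∣ n} μ(n) a_n)/2` — sifting to `z = x^{1/3}` already isolates the primes, so a
linear-sieve LOWER bound of level `D = x^θ`, `s = 3θ > 2`, applies. [folklore] -/
theorem prime_of_squarefree_of_odd_of_rough {n : ℕ} (hn : Squarefree n) (hodd : Odd (ω n))
    {x z : ℝ} (hz : 0 ≤ z) (hnx : (n : ℝ) ≤ x) (hxz : x < z ^ 3)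
    (hrough : ∀ p ∈ n.primeFactors, z ≤ (p : ℝ)) : n.Prime := by
  have hpow := pow_cardDistinctFactors_le_of_le_primeFactors hn hz hrough
  -- `ω n ≤ 2`: otherwise `z ^ 3 ≤ z ^ ω n ≤ n ≤ x < z ^ 3`
  have hω : ω n ≤ 2 := by
    by_contra h
    push Not at h
    rcases le_or_gt 1 z with hz1 | hz1
    · have : z ^ 3 ≤ z ^ ω n := pow_le_pow_right₀ hz1 (by omega)
      linarith
    · -- `z < 1`: then `n ≤ x < z³ < 1`, so `n = 0`, whose `ω` is `0`, not odd
      have hz3 : z ^ 3 < 1 := pow_lt_one₀ hz hz1 (by norm_num)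
      have hn0 : n < 1 := by exact_mod_cast (show (n : ℝ) < 1 by linarith)
      have : n = 0 := by omega
      subst this
      simp at hodd
  -- `ω n` odd and `≤ 2` forces `ω n = 1`
  have hω1 : ω n = 1 := by
    obtain ⟨k, hk⟩ := hodd
    omega
  -- squarefree prime powers are primes
  obtain ⟨p, k, hp, hk, rfl⟩ := (ArithmeticFunction.cardDistinctFactors_eq_one_iff.mp hω1)
  have hk1 : k = 1 := by
    by_contra hk1
    have h2k : 2 ≤ k := by omega
    have : p * p ∣ p ^ k := by
      rw [← pow_two]; exact pow_dvd_pow p h2k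
    have hunit := hn p this
    exact hp.not_unit (by simpa using hunit)
  subst hk1
  simpa using hp.nat_prime

/-- **Sifting the odd squarefree part to `z > x^{1/3}` leaves exactly the primes in `[z, x]`.**
For any weights `a` and `0 ≤ x < z³`:
`∑_{n ≤ x, n squarefree, ω(n) odd, p ∣ n ⇒ p ≥ z} a_n = ∑_{z ≤ p ≤ x} a_p`. Hence, for a
non-negative sequence whose ODD part `a_n 1[μ(n) = −1]` has known Type-I data of level `D = x^θ`
(which is the case as soon as both `A_d(x)` and the twisted sums `∑_{n ≤ x, d ∣ n} μ(n) a_n` are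
controlled for `d ≤ x^θ`, `a` bounded), the prime mass `∑_{x^{1/3} < p ≤ x} a_p` is a sifting
function `S(𝒜⁻, P(z))` with `s = log D / log z = 3θ`, to which the linear-sieve LOWER bound
`f(s) > 0` (`s > 2`, i.e. `θ > 2/3`; tree: `Literature.NumberTheory.Sieve.LinearSieve.jurkatRichert_lower_allLevels`,
PROVED) applies — the parity split defeats Selberg's mechanism. [folklore] -/
theorem sum_oddSquarefree_rough_eq_sum_primes (a : ℕ → ℝ) {x z : ℝ} (hx : 0 ≤ x) (hz : 0 ≤ z)
    (hxz : x < z ^ 3) :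
    ∑ n ∈ (Ioc 0 ⌊x⌋₊).filter
        (fun n : ℕ => Squarefree n ∧ Odd (ω n) ∧ ∀ p ∈ n.primeFactors, z ≤ (p : ℝ)), a n =
      ∑ p ∈ (Ioc 0 ⌊x⌋₊).filter (fun p : ℕ => p.Prime ∧ z ≤ (p : ℝ)), a p := by
  refine sum_congr (filter_congr fun n hn => ?_) fun _ _ => rfl
  have hnx : (n : ℝ) ≤ x := (Nat.cast_le.mpr (mem_Ioc.mp hn).2).trans (Nat.floor_le hx)
  constructor
  · rintro ⟨hsq, hodd, hrough⟩
    have hp := prime_of_squarefree_of_odd_of_rough hsq hodd hz hnx hxz hrough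
    exact ⟨hp, hrough n (by simp [hp])⟩
  · rintro ⟨hp, hzp⟩
    refine ⟨hp.prime.squarefree, ?_, fun q hq => ?_⟩
    · simp [ArithmeticFunction.cardDistinctFactors_apply_prime hp]
    · rw [hp.primeFactors, mem_singleton] at hq
      rw [hq]; exact hzp

end ParitySplit

end Literature.Barriers.Parity
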